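import Mathlib

/-!
# Atoms SP and RW — kernel-checked algebraic cores (g9, res-B-lens-3)

Companion to `Lines/valuative-constant-step-singledirection.md` §12.11.8.

* `sp_core` — LEMMA SP (simple-pole absorption), ring-level core: if a derivation `D` of a
  field `L` maps a subring `T` into `T + T·(Q/t)`, with `D t ∈ t·T` and `D Q ∈ Q·T`, then the
  subring `T[Q/t]` is `D`-stable.  (The valuative dichotomy and the localisation at the centre
  of the arc are not typed here.)
* `rw_step`, `rw_iter` — LEMMA RW (resonance walk), the exact bookkeeping identity:
  if `D e = θ` and `D f = f·(κ/e + ρ)` then `D (f/e^m) = (f/e^m)·((κ - m·θ)/e + ρ)`; so the pole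
  coefficient walks `κ, κ - θ, κ - 2θ, …` and vanishes modulo `e` exactly when `κ ≡ m·θ`, which in
  characteristic `p` happens for some `m < p` iff `κ/θ ∈ 𝔽_p` (§12.11.7).

No `sorry`.  Nothing here proves resolution in characteristic `p`; counted 0.
-/

namespace Summit.ResolutionOfSingularities.ResolutionOfSingularities.Cruxes.DescentPerfectToAll.Atoms

variable {L : Type*} [Field L]

/-- LEMMA SP, ring-level core: `T[Q/t]` is stable under `D`. -/
theorem sp_core (D : Derivation ℤ L L) (T : Subring L) {t Q : L} (ht : t ≠ 0)
    (htT : t ∈ T) (hQT : Q ∈ T)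
    (hDt : ∃ a ∈ T, D t = t * a) (hDQ : ∃ c ∈ T, D Q = Q * c)
    (hDT : ∀ f ∈ T, ∃ a ∈ T, ∃ b ∈ T, D f = a + b * (Q / t)) :
    ∀ f ∈ Subring.closure ((T : Set L) ∪ {Q / t}),
      D f ∈ Subring.closure ((T : Set L) ∪ {Q / t}) := by
  classical
  set S : Set L := (T : Set L) ∪ {Q / t} with hS
  have hT_sub : ∀ x ∈ T, x ∈ Subring.closure S := fun x hx =>
    Subring.subset_closure (Or.inl hx)
  have hq : Q / t ∈ Subring.closure S := Subring.subset_closure (Or.inr rfl)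
  intro f hf
  induction hf using Subring.closure_induction with
  | mem x hx =>
      rcases hx with hxT | hxq
      · obtain ⟨a, haT, b, hbT, hDx⟩ := hDT x hxT
        rw [hDx]
        exact add_mem (hT_sub a haT) (mul_mem (hT_sub b hbT) hq)
      · -- x = Q / t
        have hx' : x = Q / t := hxq
        obtain ⟨a, haT, hDt'⟩ := hDt
        obtain ⟨c, hcT, hDQ'⟩ := hDQ
        have key : D x = (Q / t) * (c - a) := by
          subst hx'
          rw [Derivation.leibniz_div, hDt', hDQ']
          simp only [smul_eq_mul]
          field_simp
        rw [key]
        exact mul_mem hq (sub_mem (hT_sub c hcT) (hT_sub a haT))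
  | zero => simp
  | one => simp
  | add x y hx hy ihx ihy =>
      rw [map_add]
      exact add_mem ihx ihy
  | neg x hx ihx =>
      rw [map_neg]
      exact neg_mem ihx
  | mul x y hx hy ihx ihy =>
      rw [Derivation.leibniz]
      simp only [smul_eq_mul]
      exact add_mem (mul_mem hx ihy) (mul_mem hy ihx)

/-- LEMMA RW, one step of the walk: the pole coefficient drops by `θ = D e`. -/
theorem rw_step (D : Derivation ℤ L L) {e f κ ρ θ : L} (he : e ≠ 0)
    (hDe : D e = θ) (hDf : D f = f * (κ / e + ρ)) :
    D (f / e) = (f / e) * ((κ - θ) / e + ρ) := by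
  rw [Derivation.leibniz_div, hDe, hDf]
  simp only [smul_eq_mul]
  field_simp
  ring

/-- LEMMA RW, the walk: after `m` divisions by `e` the pole coefficient is `κ - m·θ`. -/
theorem rw_iter (D : Derivation ℤ L L) {e f κ ρ θ : L} (he : e ≠ 0)
    (hDe : D e = θ) (hDf : D f = f * (κ / e + ρ)) (m : ℕ) :
    D (f / e ^ m) = (f / e ^ m) * ((κ - m * θ) / e + ρ) := by
  induction m with
  | zero => simpa using hDf
  | succ m ih =>
      have h1 : f / e ^ (m + 1) = (f / e ^ m) / e := by
        rw [pow_succ, div_div]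
      have h2 := rw_step D he hDe ih
      rw [h1, h2]
      congr 1
      push_cast
      ring

/-- The walk ends: if `κ = m₀·θ + η` then at step `m₀` the coefficient is `η`
(in the application `η ∈ (e, f)T`, so the pole is gone — §12.11.8 (a)). -/
theorem rw_end (D : Derivation ℤ L L) {e f κ ρ θ η : L} (he : e ≠ 0)
    (hDe : D e = θ) (hDf : D f = f * (κ / e + ρ)) (m₀ : ℕ) (hκ : κ = m₀ * θ + η) :
    D (f / e ^ m₀) = (f / e ^ m₀) * (η / e + ρ) := by
  rw [rw_iter D he hDe hDf m₀, hκ]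
  congr 2
  ring

end Summit.ResolutionOfSingularities.ResolutionOfSingularities.Cruxes.DescentPerfectToAll.Atoms
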